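import Mathlib
import HarnessLib
import Summits.ValiantsHypothesis.ValiantsHypothesis.Theses.MonotoneRestoration
import Literature.Computability.AlgebraicComplexity.ArithCircuit
import Literature.Computability.AlgebraicComplexity.ArithCircuitProofs
import Literature.Computability.AlgebraicComplexity.MonotoneStructure
import Literature.Computability.AlgebraicComplexity.PermanentIrreducible
import Literature.ModelTheory.FiniteModelTheory.CkEquiv
import Summits.ValiantsHypothesis.ValiantsHypothesis.Theorems.MonotoneRestorationMonotoneRestorationQPCosetCount
import Summits.ValiantsHypothesis.ValiantsHypothesis.Theorems.MonotoneRestorationMonotoneRestorationQPSymmetricLB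
import Summits.ValiantsHypothesis.ValiantsHypothesis.Theorems.MonotoneRestorationMonotoneRestorationQPSupportSymmetrisation
import Summits.ValiantsHypothesis.ValiantsHypothesis.Theorems.MonotoneRestorationMonotoneRestorationQPSparseRegime
import Summits.ValiantsHypothesis.ValiantsHypothesis.Theorems.MonotoneRestorationMonotoneRestorationQPBeta
import Literature.Computability.AlgebraicComplexity.SymmetricArithCircuit
import Literature.Computability.AlgebraicComplexity.DawarWilsenach2025Proofs
import Literature.GroupTheory.PermutationGroups.SmallIndexSubgroups
import Summits.ValiantsHypothesis.ValiantsHypothesis.Theorems.MonotoneRestorationQP.Negative.LoadBearing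
import Summits.ValiantsHypothesis.ValiantsHypothesis.Theorems.MonotoneRestorationMonotoneRestorationQPPermSupportCount

/-! TTRL-lite variant V18978 of stmt-ValiantsHypothesis-15886

Move `strengthen_hyp` (boundary probe): factor `2` instead of `3` in
`stub_monotoneComputation_of_complexity` ("every `f : MvPolynomial σ ℝ≥0` has a Jerrum–Snir
monotone computation of size `≤ 2 · complexity f`").  This is FALSE.

Witness: `σ = Fin 2`, `f = C 2 * X 0 + C 3 * X 1`.  The single weighted sum gate
`2 • x₀ + 3 • x₁` computes `f`, so `complexity f ≤ 1`; but no PLAIN fan-in-two circuit with at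
most two gates computes `f`.  The lower bound is proved through the semiring homomorphism
`Φ p = (p(0,0), p(1,0), p(0,1)) ∈ ℝ³`: operand values map to `(0,1,0)`, `(0,0,1)` or a diagonal
triple `(c,c,c)`, one plain gate combines two of them by `+` or `·`, the second gate combines the
first gate's value with an operand value (or with itself), and a finite case analysis in real
arithmetic shows that `Φ f = (0,2,3)` is never reached.
-/

-- `Summit.ValiantsHypothesis.ValiantsHypothesis.…` is the tree's mandated single-conjunct layout
-- (Sub = Summit), so the duplicated namespace component is intended.
set_option linter.dupNamespace false

namespace Summit.ValiantsHypothesis.ValiantsHypothesis.Theorems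

open Summit.ValiantsHypothesis.ValiantsHypothesis.Theses.MonotoneRestoration
open Literature.Computability.AlgebraicComplexity

/-- A plain gate (all sum coefficients `1`) of fan-in at most two evaluates to `0`, to `1`, to an
operand value, or to the sum or the product of two operand values (helper for TTRL-lite variant
V18978). [folklore] -/
theorem plainGate_eval_cases_var18978 {k : Type*} {σ : Type*} [CommSemiring k]
    (vals : List (MvPolynomial σ k)) (g : ArithCircuit.Gate k σ) (hf : g.fanIn ≤ 2)
    (hp : Literature.Barriers.ValiantsHypothesis.IsPlainGate g) :
    g.eval vals = 0 ∨ g.eval vals = 1 ∨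
      (∃ u : ArithCircuit.Operand k σ, g.eval vals = u.eval vals) ∨
      (∃ u v : ArithCircuit.Operand k σ,
        g.eval vals = u.eval vals + v.eval vals ∨ g.eval vals = u.eval vals * v.eval vals) := by
  cases g with
  | sum args =>
    rw [Literature.Barriers.ValiantsHypothesis.isPlainGate_sum_iff] at hp
    simp only [ArithCircuit.Gate.fanIn, ArithCircuit.Gate.args, List.length_map] at hf
    rcases args with _ | ⟨a, _ | ⟨b, _ | ⟨c, rest⟩⟩⟩
    · exact Or.inl (by simp [ArithCircuit.Gate.eval])
    · have ha : a.1 = 1 := hp a (by simp)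
      exact Or.inr (Or.inr (Or.inl ⟨a.2, by simp [ArithCircuit.Gate.eval, ha]⟩))
    · have ha : a.1 = 1 := hp a (by simp)
      have hb : b.1 = 1 := hp b (by simp)
      exact Or.inr (Or.inr (Or.inr ⟨a.2, b.2, Or.inl (by simp [ArithCircuit.Gate.eval, ha, hb])⟩))
    · exact absurd hf (by simp only [List.length_cons]; omega)
  | prod args =>
    simp only [ArithCircuit.Gate.fanIn, ArithCircuit.Gate.args] at hf
    rcases args with _ | ⟨u, _ | ⟨v, _ | ⟨w, rest⟩⟩⟩
    · exact Or.inr (Or.inl (by simp [ArithCircuit.Gate.eval]))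
    · exact Or.inr (Or.inr (Or.inl ⟨u, by simp [ArithCircuit.Gate.eval]⟩))
    · exact Or.inr (Or.inr (Or.inr ⟨u, v, Or.inr (by simp [ArithCircuit.Gate.eval])⟩))
    · exact absurd hf (by simp only [List.length_cons]; omega)

/-- An operand evaluates to a variable `X i`, to a constant `C c` (junk gate references give
`0 = C 0`), or to one of the gate values computed so far (helper for TTRL-lite variant V18978).
[folklore] -/
theorem operand_eval_cases_var18978 {k : Type*} {σ : Type*} [CommSemiring k]
    (vals : List (MvPolynomial σ k)) (u : ArithCircuit.Operand k σ) :
    (∃ i : σ, u.eval vals = MvPolynomial.X i) ∨ (∃ c : k, u.eval vals = MvPolynomial.C c) ∨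
      u.eval vals ∈ vals := by
  cases u with
  | var i => exact Or.inl ⟨i, rfl⟩
  | const c => exact Or.inr (Or.inl ⟨c, rfl⟩)
  | gate j =>
    rw [ArithCircuit.Operand.eval_gate, List.getD_eq_getElem?_getD]
    by_cases hj : j < vals.length
    · exact Or.inr (Or.inr (by simp [List.getElem?_eq_getElem hj]))
    · exact Or.inr (Or.inl ⟨0, by simp [List.getElem?_eq_none (not_lt.mp hj)]⟩)

/-- Structural induction over plain fan-in-two circuits with at most two gates: if `L0` holds for
variables and constants, `L1` is generated from `L0` by one plain binary gate and `L2` from `L1`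
by a second plain binary gate one of whose inputs is the first gate, then the polynomial computed
by any plain fan-in-two circuit of size `≤ 2` satisfies `L2` (helper for TTRL-lite variant V18978).
[folklore] -/
theorem small_plain_eval_var18978 {k : Type*} {σ : Type*} [CommSemiring k]
    (L0 L1 L2 : MvPolynomial σ k → Prop)
    (hX : ∀ i, L0 (MvPolynomial.X i)) (hC : ∀ c, L0 (MvPolynomial.C c))
    (h01 : ∀ p, L0 p → L1 p) (h12 : ∀ p, L1 p → L2 p)
    (hL1 : ∀ u v, L0 u → L0 v → L1 (u + v) ∧ L1 (u * v))
    (hL2 : ∀ g w, L1 g → (L0 w ∨ w = g) → L2 (g + w) ∧ L2 (w + g) ∧ L2 (g * w) ∧ L2 (w * g))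
    (P : ArithCircuit k σ) (h2 : P.IsFanInTwo)
    (hpl : Literature.Barriers.ValiantsHypothesis.IsPlain P) (hs : P.size ≤ 2) : L2 P.eval := by
  -- level 0: operands against the empty value list
  have hop0 : ∀ u : ArithCircuit.Operand k σ, L0 (u.eval []) := by
    intro u
    rcases operand_eval_cases_var18978 [] u with ⟨i, hi⟩ | ⟨c, hc⟩ | hmem
    · rw [hi]; exact hX i
    · rw [hc]; exact hC c
    · simp at hmem
  have hL0zero : L0 0 := by simpa using hC 0
  have hL0one : L0 1 := by simpa using hC 1
  have hL2_of_L0 : ∀ p, L0 p → L2 p := fun p hp => h12 p (h01 p hp)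
  -- level 1: a plain fan-in-two gate against the empty value list
  have hg0 : ∀ g : ArithCircuit.Gate k σ, g.fanIn ≤ 2 →
      Literature.Barriers.ValiantsHypothesis.IsPlainGate g → L1 (g.eval []) := by
    intro g hf hp
    rcases plainGate_eval_cases_var18978 [] g hf hp with h | h | ⟨u, h⟩ | ⟨u, v, h | h⟩ <;> rw [h]
    · exact h01 _ hL0zero
    · exact h01 _ hL0one
    · exact h01 _ (hop0 u)
    · exact (hL1 _ _ (hop0 u) (hop0 v)).1
    · exact (hL1 _ _ (hop0 u) (hop0 v)).2
  -- level 2: operands and a plain fan-in-two gate against a one-element value list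
  have hop1 : ∀ (v0 : MvPolynomial σ k) (u : ArithCircuit.Operand k σ),
      L0 (u.eval [v0]) ∨ u.eval [v0] = v0 := by
    intro v0 u
    rcases operand_eval_cases_var18978 [v0] u with ⟨i, hi⟩ | ⟨c, hc⟩ | hmem
    · exact Or.inl (by rw [hi]; exact hX i)
    · exact Or.inl (by rw [hc]; exact hC c)
    · exact Or.inr (by simpa using hmem)
  have hg1 : ∀ (v0 : MvPolynomial σ k) (g : ArithCircuit.Gate k σ), L1 v0 → g.fanIn ≤ 2 →
      Literature.Barriers.ValiantsHypothesis.IsPlainGate g → L2 (g.eval [v0]) := by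
    intro v0 g hv0 hf hp
    have hone : ∀ u : ArithCircuit.Operand k σ, L2 (u.eval [v0]) := by
      intro u
      rcases hop1 v0 u with h | h
      · exact hL2_of_L0 _ h
      · rw [h]; exact h12 _ hv0
    have htwo : ∀ u v : ArithCircuit.Operand k σ,
        L2 (u.eval [v0] + v.eval [v0]) ∧ L2 (u.eval [v0] * v.eval [v0]) := by
      intro u v
      rcases hop1 v0 u with hu | hu <;> rcases hop1 v0 v with hv | hv
      · exact ⟨h12 _ (hL1 _ _ hu hv).1, h12 _ (hL1 _ _ hu hv).2⟩
      · rw [hv]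
        exact ⟨(hL2 v0 _ hv0 (Or.inl hu)).2.1, (hL2 v0 _ hv0 (Or.inl hu)).2.2.2⟩
      · rw [hu]
        exact ⟨(hL2 v0 _ hv0 (Or.inl hv)).1, (hL2 v0 _ hv0 (Or.inl hv)).2.2.1⟩
      · rw [hu, hv]
        exact ⟨(hL2 v0 v0 hv0 (Or.inr rfl)).1, (hL2 v0 v0 hv0 (Or.inr rfl)).2.2.1⟩
    rcases plainGate_eval_cases_var18978 [v0] g hf hp with h | h | ⟨u, h⟩ | ⟨u, v, h | h⟩ <;>
      rw [h]
    · exact hL2_of_L0 _ hL0zero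
    · exact hL2_of_L0 _ hL0one
    · exact hone u
    · exact (htwo u v).1
    · exact (htwo u v).2
  -- case analysis on the number of gates
  obtain ⟨gates, out⟩ := P
  simp only [ArithCircuit.IsFanInTwo, Literature.Barriers.ValiantsHypothesis.IsPlain,
    ArithCircuit.size] at h2 hpl hs
  rcases gates with _ | ⟨g0, _ | ⟨g1, _ | ⟨g2, rest⟩⟩⟩
  · -- no gates: the output is an operand value
    show L2 (out.eval (ArithCircuit.gateValues []))
    have hgv : ArithCircuit.gateValues ([] : List (ArithCircuit.Gate k σ)) = [] := rfl
    rw [hgv]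
    exact hL2_of_L0 _ (hop0 out)
  · -- one gate
    have hv0 : L1 (g0.eval []) := hg0 g0 (h2 g0 (by simp)) (hpl g0 (by simp))
    show L2 (out.eval (ArithCircuit.gateValues [g0]))
    have hgv : ArithCircuit.gateValues [g0] = [g0.eval []] := rfl
    rw [hgv]
    rcases hop1 (g0.eval []) out with h | h
    · exact hL2_of_L0 _ h
    · rw [h]; exact h12 _ hv0
  · -- two gates
    have hv0 : L1 (g0.eval []) := hg0 g0 (h2 g0 (by simp)) (hpl g0 (by simp))
    have hv1 : L2 (g1.eval [g0.eval []]) :=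
      hg1 _ g1 hv0 (h2 g1 (by simp)) (hpl g1 (by simp))
    show L2 (out.eval (ArithCircuit.gateValues [g0, g1]))
    have hgv : ArithCircuit.gateValues [g0, g1] = [g0.eval [], g1.eval [g0.eval []]] := rfl
    rw [hgv]
    rcases operand_eval_cases_var18978 [g0.eval [], g1.eval [g0.eval []]] out with
      ⟨i, hi⟩ | ⟨c, hc⟩ | hmem
    · rw [hi]; exact hL2_of_L0 _ (hX i)
    · rw [hc]; exact hL2_of_L0 _ (hC c)
    · simp only [List.mem_cons, List.not_mem_nil, or_false] at hmem
      rcases hmem with h | h <;> rw [h]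
      · exact h12 _ hv0
      · exact hv1
  · -- three or more gates: excluded by the size bound
    exact absurd hs (by simp only [List.length_cons]; omega)

/-- Arithmetic core, first gate: in `ℝ³ ∋ (z,a,b) = (p(0,0), p(1,0), p(0,1))`, no operand value
(`(0,1,0)`, `(0,0,1)`, diagonal) and no sum or product of two operand values equals `(0,2,3)`
(helper for TTRL-lite variant V18978). [folklore] -/
theorem level1_ne_var18978 (z a b : ℝ)
    (h : ((z = 0 ∧ a = 1 ∧ b = 0) ∨ (z = 0 ∧ a = 0 ∧ b = 1) ∨ (a = z ∧ b = z)) ∨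
      ∃ z₁ a₁ b₁ z₂ a₂ b₂ : ℝ,
        ((z₁ = 0 ∧ a₁ = 1 ∧ b₁ = 0) ∨ (z₁ = 0 ∧ a₁ = 0 ∧ b₁ = 1) ∨ (a₁ = z₁ ∧ b₁ = z₁)) ∧
        ((z₂ = 0 ∧ a₂ = 1 ∧ b₂ = 0) ∨ (z₂ = 0 ∧ a₂ = 0 ∧ b₂ = 1) ∨ (a₂ = z₂ ∧ b₂ = z₂)) ∧
        ((z = z₁ + z₂ ∧ a = a₁ + a₂ ∧ b = b₁ + b₂) ∨
          (z = z₁ * z₂ ∧ a = a₁ * a₂ ∧ b = b₁ * b₂)))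
    (hz : z = 0) (ha : a = 2) (hb : b = 3) : False := by
  rcases h with (⟨rfl, rfl, rfl⟩ | ⟨rfl, rfl, rfl⟩ | ⟨rfl, rfl⟩) |
    ⟨z₁, a₁, b₁, z₂, a₂, b₂, (⟨rfl, rfl, rfl⟩ | ⟨rfl, rfl, rfl⟩ | ⟨rfl, rfl⟩),
      (⟨rfl, rfl, rfl⟩ | ⟨rfl, rfl, rfl⟩ | ⟨rfl, rfl⟩), (⟨rfl, rfl, rfl⟩ | ⟨rfl, rfl, rfl⟩)⟩ <;>
    linarith

/-- Arithmetic core, second gate: in `ℝ³`, if `g` is a first-gate value (an operand value or a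
sum/product of two operand values) and `w` is an operand value or `w = g`, then neither `g + w`
nor `g * w` equals `(0,2,3)` (helper for TTRL-lite variant V18978). [folklore] -/
theorem level2_ne_var18978 (z₁ a₁ b₁ z₂ a₂ b₂ : ℝ)
    (h₁ : ((z₁ = 0 ∧ a₁ = 1 ∧ b₁ = 0) ∨ (z₁ = 0 ∧ a₁ = 0 ∧ b₁ = 1) ∨ (a₁ = z₁ ∧ b₁ = z₁)) ∨
      ∃ z₃ a₃ b₃ z₄ a₄ b₄ : ℝ,
        ((z₃ = 0 ∧ a₃ = 1 ∧ b₃ = 0) ∨ (z₃ = 0 ∧ a₃ = 0 ∧ b₃ = 1) ∨ (a₃ = z₃ ∧ b₃ = z₃)) ∧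
        ((z₄ = 0 ∧ a₄ = 1 ∧ b₄ = 0) ∨ (z₄ = 0 ∧ a₄ = 0 ∧ b₄ = 1) ∨ (a₄ = z₄ ∧ b₄ = z₄)) ∧
        ((z₁ = z₃ + z₄ ∧ a₁ = a₃ + a₄ ∧ b₁ = b₃ + b₄) ∨
          (z₁ = z₃ * z₄ ∧ a₁ = a₃ * a₄ ∧ b₁ = b₃ * b₄)))
    (h₂ : ((z₂ = 0 ∧ a₂ = 1 ∧ b₂ = 0) ∨ (z₂ = 0 ∧ a₂ = 0 ∧ b₂ = 1) ∨ (a₂ = z₂ ∧ b₂ = z₂)) ∨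
      (z₂ = z₁ ∧ a₂ = a₁ ∧ b₂ = b₁)) :
    ((0 : ℝ) = z₁ + z₂ → (2 : ℝ) = a₁ + a₂ → (3 : ℝ) = b₁ + b₂ → False) ∧
      ((0 : ℝ) = z₁ * z₂ → (2 : ℝ) = a₁ * a₂ → (3 : ℝ) = b₁ * b₂ → False) := by
  rcases h₁ with (⟨rfl, rfl, rfl⟩ | ⟨rfl, rfl, rfl⟩ | ⟨rfl, rfl⟩) |
    ⟨z₃, a₃, b₃, z₄, a₄, b₄, (⟨rfl, rfl, rfl⟩ | ⟨rfl, rfl, rfl⟩ | ⟨rfl, rfl⟩),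
      (⟨rfl, rfl, rfl⟩ | ⟨rfl, rfl, rfl⟩ | ⟨rfl, rfl⟩), (⟨rfl, rfl, rfl⟩ | ⟨rfl, rfl, rfl⟩)⟩ <;>
  rcases h₂ with (⟨rfl, rfl, rfl⟩ | ⟨rfl, rfl, rfl⟩ | ⟨rfl, rfl⟩) | ⟨rfl, rfl, rfl⟩ <;>
  refine ⟨fun hz ha hb => ?_, fun hz ha hb => ?_⟩ <;>
  linarith

/-- The lower bound behind TTRL-lite variant V18978: for three semiring homomorphisms
`φz, φa, φb : MvPolynomial (Fin 2) ℝ≥0 →+* ℝ` taking the values of the evaluations at `(0,0)`,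
`(1,0)`, `(0,1)` on variables and agreeing on constants, no plain fan-in-two circuit with at most
two gates computes a polynomial with `(φz, φa, φb) = (0, 2, 3)` — in particular not
`C 2 * X 0 + C 3 * X 1`. [folklore] -/
theorem ne_of_small_plain_var18978 (φz φa φb : MvPolynomial (Fin 2) NNReal →+* ℝ)
    (hz0 : φz (MvPolynomial.X 0) = 0) (ha0 : φa (MvPolynomial.X 0) = 1)
    (hb0 : φb (MvPolynomial.X 0) = 0) (hz1 : φz (MvPolynomial.X 1) = 0)
    (ha1 : φa (MvPolynomial.X 1) = 0) (hb1 : φb (MvPolynomial.X 1) = 1)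
    (hC : ∀ c : NNReal, φa (MvPolynomial.C c) = φz (MvPolynomial.C c) ∧
      φb (MvPolynomial.C c) = φz (MvPolynomial.C c))
    (P : ArithCircuit NNReal (Fin 2)) (h2 : P.IsFanInTwo)
    (hpl : Literature.Barriers.ValiantsHypothesis.IsPlain P) (hs : P.size ≤ 2) :
    ¬ (φz P.eval = 0 ∧ φa P.eval = 2 ∧ φb P.eval = 3) := by
  rintro ⟨ez, ea, eb⟩
  have key := small_plain_eval_var18978
    (fun p => (φz p = 0 ∧ φa p = 1 ∧ φb p = 0) ∨ (φz p = 0 ∧ φa p = 0 ∧ φb p = 1) ∨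
      (φa p = φz p ∧ φb p = φz p))
    (fun p => ((φz p = 0 ∧ φa p = 1 ∧ φb p = 0) ∨ (φz p = 0 ∧ φa p = 0 ∧ φb p = 1) ∨
        (φa p = φz p ∧ φb p = φz p)) ∨
      ∃ z₁ a₁ b₁ z₂ a₂ b₂ : ℝ,
        ((z₁ = 0 ∧ a₁ = 1 ∧ b₁ = 0) ∨ (z₁ = 0 ∧ a₁ = 0 ∧ b₁ = 1) ∨ (a₁ = z₁ ∧ b₁ = z₁)) ∧
        ((z₂ = 0 ∧ a₂ = 1 ∧ b₂ = 0) ∨ (z₂ = 0 ∧ a₂ = 0 ∧ b₂ = 1) ∨ (a₂ = z₂ ∧ b₂ = z₂)) ∧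
        ((φz p = z₁ + z₂ ∧ φa p = a₁ + a₂ ∧ φb p = b₁ + b₂) ∨
          (φz p = z₁ * z₂ ∧ φa p = a₁ * a₂ ∧ φb p = b₁ * b₂)))
    (fun p => (((φz p = 0 ∧ φa p = 1 ∧ φb p = 0) ∨ (φz p = 0 ∧ φa p = 0 ∧ φb p = 1) ∨
        (φa p = φz p ∧ φb p = φz p)) ∨
      ∃ z₁ a₁ b₁ z₂ a₂ b₂ : ℝ,
        ((z₁ = 0 ∧ a₁ = 1 ∧ b₁ = 0) ∨ (z₁ = 0 ∧ a₁ = 0 ∧ b₁ = 1) ∨ (a₁ = z₁ ∧ b₁ = z₁)) ∧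
        ((z₂ = 0 ∧ a₂ = 1 ∧ b₂ = 0) ∨ (z₂ = 0 ∧ a₂ = 0 ∧ b₂ = 1) ∨ (a₂ = z₂ ∧ b₂ = z₂)) ∧
        ((φz p = z₁ + z₂ ∧ φa p = a₁ + a₂ ∧ φb p = b₁ + b₂) ∨
          (φz p = z₁ * z₂ ∧ φa p = a₁ * a₂ ∧ φb p = b₁ * b₂))) ∨
      ∃ z₁ a₁ b₁ z₂ a₂ b₂ : ℝ,
        ((((z₁ = 0 ∧ a₁ = 1 ∧ b₁ = 0) ∨ (z₁ = 0 ∧ a₁ = 0 ∧ b₁ = 1) ∨ (a₁ = z₁ ∧ b₁ = z₁)) ∨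
          ∃ z₃ a₃ b₃ z₄ a₄ b₄ : ℝ,
            ((z₃ = 0 ∧ a₃ = 1 ∧ b₃ = 0) ∨ (z₃ = 0 ∧ a₃ = 0 ∧ b₃ = 1) ∨ (a₃ = z₃ ∧ b₃ = z₃)) ∧
            ((z₄ = 0 ∧ a₄ = 1 ∧ b₄ = 0) ∨ (z₄ = 0 ∧ a₄ = 0 ∧ b₄ = 1) ∨ (a₄ = z₄ ∧ b₄ = z₄)) ∧
            ((z₁ = z₃ + z₄ ∧ a₁ = a₃ + a₄ ∧ b₁ = b₃ + b₄) ∨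
              (z₁ = z₃ * z₄ ∧ a₁ = a₃ * a₄ ∧ b₁ = b₃ * b₄))) ∧
        (((z₂ = 0 ∧ a₂ = 1 ∧ b₂ = 0) ∨ (z₂ = 0 ∧ a₂ = 0 ∧ b₂ = 1) ∨ (a₂ = z₂ ∧ b₂ = z₂)) ∨
          (z₂ = z₁ ∧ a₂ = a₁ ∧ b₂ = b₁)) ∧
        ((φz p = z₁ + z₂ ∧ φa p = a₁ + a₂ ∧ φb p = b₁ + b₂) ∨
          (φz p = z₁ * z₂ ∧ φa p = a₁ * a₂ ∧ φb p = b₁ * b₂))))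
    ?_ ?_ (fun p hp => Or.inl hp) (fun p hp => Or.inl hp) ?_ ?_ P h2 hpl hs
  · -- conclude from the arithmetic core
    rcases key with hk | ⟨z₁, a₁, b₁, z₂, a₂, b₂, hg, hw, hk⟩
    · exact level1_ne_var18978 _ _ _ hk ez ea eb
    · rw [ez, ea, eb] at hk
      rcases hk with ⟨h1, h2', h3⟩ | ⟨h1, h2', h3⟩
      · exact (level2_ne_var18978 _ _ _ _ _ _ hg hw).1 h1 h2' h3
      · exact (level2_ne_var18978 _ _ _ _ _ _ hg hw).2 h1 h2' h3
  · -- variables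
    intro i
    fin_cases i
    · exact Or.inl ⟨hz0, ha0, hb0⟩
    · exact Or.inr (Or.inl ⟨hz1, ha1, hb1⟩)
  · -- constants
    intro c
    exact Or.inr (Or.inr (hC c))
  · -- one gate over two operand values
    intro u v hu hv
    exact ⟨Or.inr ⟨_, _, _, _, _, _, hu, hv, Or.inl ⟨map_add _ _ _, map_add _ _ _, map_add _ _ _⟩⟩,
      Or.inr ⟨_, _, _, _, _, _, hu, hv, Or.inr ⟨map_mul _ _ _, map_mul _ _ _, map_mul _ _ _⟩⟩⟩
  · -- second gate over the first gate's value and an operand value (or itself)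
    intro g w hg hw
    have hw' : ((φz w = 0 ∧ φa w = 1 ∧ φb w = 0) ∨ (φz w = 0 ∧ φa w = 0 ∧ φb w = 1) ∨
        (φa w = φz w ∧ φb w = φz w)) ∨ (φz w = φz g ∧ φa w = φa g ∧ φb w = φb g) := by
      rcases hw with hw | rfl
      · exact Or.inl hw
      · exact Or.inr ⟨rfl, rfl, rfl⟩
    refine ⟨Or.inr ⟨_, _, _, _, _, _, hg, hw', Or.inl ⟨map_add _ _ _, map_add _ _ _, map_add _ _ _⟩⟩,
      Or.inr ⟨_, _, _, _, _, _, hg, hw', Or.inl ⟨?_, ?_, ?_⟩⟩,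
      Or.inr ⟨_, _, _, _, _, _, hg, hw', Or.inr ⟨map_mul _ _ _, map_mul _ _ _, map_mul _ _ _⟩⟩,
      Or.inr ⟨_, _, _, _, _, _, hg, hw', Or.inr ⟨?_, ?_, ?_⟩⟩⟩
    · rw [map_add, add_comm]
    · rw [map_add, add_comm]
    · rw [map_add, add_comm]
    · rw [map_mul, mul_comm]
    · rw [map_mul, mul_comm]
    · rw [map_mul, mul_comm]

/-- **TTRL-lite variant V18978 of `stub_monotoneComputation_of_complexity` is FALSE** (move
`strengthen_hyp`, factor `2` instead of `3`).

Witness: `σ = Fin 2`, `f = C 2 * X 0 + C 3 * X 1`.  The one-gate weighted circuit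
`sum [(2, x₀), (3, x₁)]` computes `f`, so `complexity f ≤ 1` and the claimed bound forces a
Jerrum–Snir monotone computation (plain, fan-in two) with at most `2` gates; by
`ne_of_small_plain_var18978` (evaluate at `(0,0)`, `(1,0)`, `(0,1)`) no such circuit computes
`f`.  So the factor `3` of the tree's `stub_monotoneComputation_of_complexity` cannot be lowered
to `2`: a weighted gate `c • u + d • v` with two distinct non-unit weights genuinely costs three
plain gates. [cite: JerrumSnir1982, §2.2] -/
theorem stub_monotoneComputation_of_complexity_var18978_false :
    ¬ (∀ (σ : Type) (f : MvPolynomial σ NNReal), ∃ P : ArithCircuit NNReal σ,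
        Literature.Barriers.ValiantsHypothesis.IsMonotoneComputation P f ∧
        P.size ≤ 2 * complexity f) := by
  intro h
  obtain ⟨P, ⟨h2, hpl, hcomp⟩, hsize⟩ := h (Fin 2)
    (MvPolynomial.C 2 * MvPolynomial.X 0 + MvPolynomial.C 3 * MvPolynomial.X 1)
  -- upper bound: the single weighted sum gate `2 • x₀ + 3 • x₁`
  have hc : complexity (MvPolynomial.C 2 * MvPolynomial.X 0 + MvPolynomial.C 3 * MvPolynomial.X 1 :
      MvPolynomial (Fin 2) NNReal) ≤ 1 := by
    refine (ArithCircuit.complexity_le_size (k := NNReal) (σ := Fin 2)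
      (P := ⟨[ArithCircuit.Gate.sum [((2 : NNReal), ArithCircuit.Operand.var 0),
        ((3 : NNReal), ArithCircuit.Operand.var 1)]], ArithCircuit.Operand.gate 0⟩) ?_ ?_).trans
      (le_of_eq rfl)
    · intro g hg
      simp only [List.mem_singleton] at hg
      subst hg
      simp [ArithCircuit.Gate.fanIn, ArithCircuit.Gate.args]
    · simp [ArithCircuit.Computes, ArithCircuit.eval, ArithCircuit.gateValues,
        ArithCircuit.Gate.eval, ArithCircuit.Operand.eval, MvPolynomial.smul_eq_C_mul]
  have hs : P.size ≤ 2 := hsize.trans (by omega)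
  have hev : P.eval = MvPolynomial.C 2 * MvPolynomial.X 0 + MvPolynomial.C 3 * MvPolynomial.X 1 :=
    hcomp
  -- lower bound: evaluate at `(0,0)`, `(1,0)`, `(0,1)`
  refine ne_of_small_plain_var18978
    (MvPolynomial.eval₂Hom NNReal.toRealHom (fun _ : Fin 2 => (0 : ℝ)))
    (MvPolynomial.eval₂Hom NNReal.toRealHom (fun i : Fin 2 => if i = 0 then (1 : ℝ) else 0))
    (MvPolynomial.eval₂Hom NNReal.toRealHom (fun i : Fin 2 => if i = 1 then (1 : ℝ) else 0))
    (by simp) (by simp) (by simp) (by simp) (by simp) (by simp) (fun c => by simp)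
    P h2 hpl hs ⟨?_, ?_, ?_⟩
  · rw [hev]; simp
  · rw [hev]; norm_num
  · rw [hev]; norm_num

end Summit.ValiantsHypothesis.ValiantsHypothesis.Theorems
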